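import Summits.Ventures.HSemireg.DerivedDescentComp
import HarnessLib

/-!
# Venture HSemireg — descent along an EXACT BASE-CHANGE FUNCTOR: `derivedLift Φ₁ ⋙ D(G) ≅ D(G) ⋙ derivedLift Φ₂` and the
# conjugation formula for `shiftedHomMap` (piece (N3) of `HomComplex.IsISemiregularC.of_schemeIso`)

research route conditional on HC_CM; not a corollary; Q11.4-sentence-2 already refuted in dim ≥ 3.

HONEST FRAMING. Generic Mathlib-level plumbing for p3's `DerivedDescent` (`derivedLift`, `derivedLiftFac`, `shiftedHomMap`) in the
TWO-CATEGORY setting; the base-change twin of gs-g4's `DerivedDescentComp` (`derivedLiftCompIso`, `shiftedHomMap_functor_comp`).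
Nothing about any variety; nothing here says HC, HC_CM or HC_AV is proved. Seat ring2-b06 gen 118 (ring2 LEAD 151 item (B),
LEAD 152 l.4991: «the residual `IsISemiregularC.of_schemeIso` is the by-name target that remains»); this is piece (N3) of the plan
recorded in `AmplificationChainSigmaGluableOfSchemeIso.lean`: the middle factor `Φ_K(x·ι•·At(K•)^q) = shiftedHomMap (𝓗om•(K,–)) …` of
the cell's `σ_q` moves across `D(e^*)` by the theorem below, once (N1) supplies `τ : 𝓗om•(K,–) ⋙ e^*• ≅ e^*• ⋙ 𝓗om•(e^*K,–)`.

SETTING. `G : C₁ ⥤ C₂` exact between abelian categories with derived categories (`D(G) = G.mapDerivedCategory`,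
`FacG : Q₁ ⋙ D(G) ≅ G• ⋙ Q₂` = Mathlib `mapDerivedCategoryFactors`); endofunctors `Φ₁` of `CochainComplex C₁ ℤ` and `Φ₂` of
`CochainComplex C₂ ℤ` which (followed by `Q`) invert quasi-isomorphisms; an isomorphism `τ : Φ₁ ⋙ G• ≅ G• ⋙ Φ₂`.
* §1 `mapShiftedHom G y := FacG.inv_K ≫ y.map D(G) ≫ FacG.hom_L⟦n⟧'` — the action of `G` on shifted Homs of complexes
  `Hom(Q₁K, (Q₁L)⟦n⟧) → Hom(Q₂ G•K, (Q₂ G•L)⟦n⟧)` (same sandwich shape as `shiftedHomMap`); `mapShiftedHom_mk₀`.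
* §2 `derivedLiftBaseChangeIso : derivedLift Φ₁ ⋙ D(G) ≅ D(G) ⋙ derivedLift Φ₂` (uniqueness of localization lifts along `Q₁`,
  Mathlib `Localization.liftNatIso`; the two `Lifting` structures are whiskerings of `derivedLiftFac` and `FacG`), its values on
  `Q₁ K`, and its shift-compatibility when `Φ₁`, `Φ₂`, `τ` commute with shifts (`natTrans_commShift_liftNatTrans`).
* §3 **`mapShiftedHom_shiftedHomMap`** — `G_*(Φ₁_*(y)) ≫ (Q₂ τ_L)⟦n⟧' = Q₂ τ_K ≫ Φ₂_*(G_*(y))`: base change and descent commute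
  up to `τ` (Mathlib `ShiftedHom.map_naturality`, `ShiftedHom.comp_map`; all factorisation isomorphisms cancel).

References: Mathlib `CategoryTheory.Localization.Predicate` (`liftNatIso`, `Lifting`), `CategoryTheory.Shift.ShiftedHom`,
`Algebra.Homology.DerivedCategory.ExactFunctor`; [Weibel1994] §10.4, Cor. 10.4.7 (localisation at quasi-isomorphisms). [folklore]
-/

noncomputable section

open CategoryTheory CategoryTheory.Category CategoryTheory.Limits

namespace Summit.Ventures.HSemireg

universe w₁ w₂ v₁ v₂ u₁ u₂

variable {C₁ : Type u₁} [Category.{v₁} C₁] [Abelian C₁] [HasDerivedCategory.{w₁} C₁]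
  {C₂ : Type u₂} [Category.{v₂} C₂] [Abelian C₂] [HasDerivedCategory.{w₂} C₂]
  (G : C₁ ⥤ C₂) [G.Additive] [PreservesFiniteLimits G] [PreservesFiniteColimits G]

/-! ## §1 The action of an exact functor on shifted Homs of complexes -/

section MapShiftedHom

/-- **`G_*` on shifted Homs of complexes**: `y : Q₁ K ⟶ (Q₁ L)⟦n⟧ ↦ FacG.inv_K ≫ D(G)(y)♮ ≫ FacG.hom_L⟦n⟧' :
Q₂ (G• K) ⟶ (Q₂ (G• L))⟦n⟧`, where `D(G)(y)♮ = y.map D(G)` absorbs `D(G)`'s commutation with the shift and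
`FacG : Q₁ ⋙ D(G) ≅ G• ⋙ Q₂` is Mathlib's `mapDerivedCategoryFactors`. [cite: Weibel1994, §10.4 and Cor. 10.4.7] -/
def mapShiftedHom {K L : CochainComplex C₁ ℤ} {n : ℤ}
    (y : ShiftedHom (DerivedCategory.Q.obj K) (DerivedCategory.Q.obj L) n) :
    ShiftedHom (DerivedCategory.Q.obj ((G.mapHomologicalComplex (ComplexShape.up ℤ)).obj K))
      (DerivedCategory.Q.obj ((G.mapHomologicalComplex (ComplexShape.up ℤ)).obj L)) n :=
  G.mapDerivedCategoryFactors.inv.app K ≫ y.map G.mapDerivedCategory ≫ (G.mapDerivedCategoryFactors.hom.app L)⟦n⟧'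

/-- `G_*(y)` in `ShiftedHom.comp` form. [folklore] -/
theorem mapShiftedHom_eq_comp {K L : CochainComplex C₁ ℤ} {n : ℤ}
    (y : ShiftedHom (DerivedCategory.Q.obj K) (DerivedCategory.Q.obj L) n) :
    mapShiftedHom G y =
      (ShiftedHom.mk₀ 0 rfl (G.mapDerivedCategoryFactors.inv.app K)).comp
        ((y.map G.mapDerivedCategory).comp (ShiftedHom.mk₀ 0 rfl (G.mapDerivedCategoryFactors.hom.app L)) (zero_add n))
        (add_zero n) := by
  rw [ShiftedHom.comp_mk₀, ShiftedHom.mk₀_comp]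
  rfl

set_option backward.isDefEq.respectTransparency false in
/-- `G_*` on a degree-`0` class `Q₁ f`: `G_*(Q₁ f) = Q₂ (G• f)` (as a degree-`0` shifted Hom). [folklore] -/
theorem mapShiftedHom_mk₀ {K L : CochainComplex C₁ ℤ} (f : K ⟶ L) :
    mapShiftedHom G (ShiftedHom.mk₀ (0 : ℤ) rfl (DerivedCategory.Q.map f)) =
      ShiftedHom.mk₀ (0 : ℤ) rfl (DerivedCategory.Q.map ((G.mapHomologicalComplex (ComplexShape.up ℤ)).map f)) := by
  rw [mapShiftedHom_eq_comp, ShiftedHom.map_mk₀, ShiftedHom.mk₀_comp_mk₀, ShiftedHom.mk₀_comp_mk₀]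
  congr 1
  change G.mapDerivedCategoryFactors.inv.app K ≫ (DerivedCategory.Q ⋙ G.mapDerivedCategory).map f ≫
      G.mapDerivedCategoryFactors.hom.app L = (G.mapHomologicalComplex (ComplexShape.up ℤ) ⋙ DerivedCategory.Q).map f
  rw [← Category.assoc, ← G.mapDerivedCategoryFactors.inv.naturality f, Category.assoc, Iso.inv_hom_id_app,
    Category.comp_id]

end MapShiftedHom

/-! ## §2 `derivedLift Φ₁ ⋙ D(G) ≅ D(G) ⋙ derivedLift Φ₂` -/

section BaseChange

variable (Φ₁ : CochainComplex C₁ ℤ ⥤ CochainComplex C₁ ℤ) (Φ₂ : CochainComplex C₂ ℤ ⥤ CochainComplex C₂ ℤ)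
  (hΦ₁ : (HomologicalComplex.quasiIso C₁ (ComplexShape.up ℤ)).IsInvertedBy (Φ₁ ⋙ DerivedCategory.Q))
  (hΦ₂ : (HomologicalComplex.quasiIso C₂ (ComplexShape.up ℤ)).IsInvertedBy (Φ₂ ⋙ DerivedCategory.Q))

/-- `Q₁ ⋙ (derivedLift Φ₁ ⋙ D(G)) ≅ (Φ₁ ⋙ G•) ⋙ Q₂` (whiskerings of `derivedLiftFac Φ₁` and `FacG`). [folklore] -/
def liftingBaseChangeIso₁ :
    DerivedCategory.Q ⋙ (derivedLift Φ₁ hΦ₁ ⋙ G.mapDerivedCategory) ≅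
      (Φ₁ ⋙ G.mapHomologicalComplex (ComplexShape.up ℤ)) ⋙ DerivedCategory.Q :=
  (Functor.associator _ _ _).symm ≪≫ Functor.isoWhiskerRight (derivedLiftFac Φ₁ hΦ₁) _ ≪≫
    Functor.associator _ _ _ ≪≫ Functor.isoWhiskerLeft Φ₁ G.mapDerivedCategoryFactors ≪≫ (Functor.associator _ _ _).symm

/-- `Q₁ ⋙ (D(G) ⋙ derivedLift Φ₂) ≅ (G• ⋙ Φ₂) ⋙ Q₂` (whiskerings of `FacG` and `derivedLiftFac Φ₂`). [folklore] -/
def liftingBaseChangeIso₂ :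
    DerivedCategory.Q ⋙ (G.mapDerivedCategory ⋙ derivedLift Φ₂ hΦ₂) ≅
      (G.mapHomologicalComplex (ComplexShape.up ℤ) ⋙ Φ₂) ⋙ DerivedCategory.Q :=
  (Functor.associator _ _ _).symm ≪≫ Functor.isoWhiskerRight G.mapDerivedCategoryFactors _ ≪≫
    Functor.associator _ _ _ ≪≫ Functor.isoWhiskerLeft _ (derivedLiftFac Φ₂ hΦ₂) ≪≫ (Functor.associator _ _ _).symm

/-- `derivedLift Φ₁ ⋙ D(G)` lifts `(Φ₁ ⋙ G•) ⋙ Q₂` along `Q₁`. [folklore] -/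
instance liftingBaseChange₁ : Localization.Lifting DerivedCategory.Q (HomologicalComplex.quasiIso C₁ (ComplexShape.up ℤ))
    ((Φ₁ ⋙ G.mapHomologicalComplex (ComplexShape.up ℤ)) ⋙ DerivedCategory.Q) (derivedLift Φ₁ hΦ₁ ⋙ G.mapDerivedCategory) :=
  ⟨liftingBaseChangeIso₁ G Φ₁ hΦ₁⟩

/-- `D(G) ⋙ derivedLift Φ₂` lifts `(G• ⋙ Φ₂) ⋙ Q₂` along `Q₁`. [folklore] -/
instance liftingBaseChange₂ : Localization.Lifting DerivedCategory.Q (HomologicalComplex.quasiIso C₁ (ComplexShape.up ℤ))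
    ((G.mapHomologicalComplex (ComplexShape.up ℤ) ⋙ Φ₂) ⋙ DerivedCategory.Q) (G.mapDerivedCategory ⋙ derivedLift Φ₂ hΦ₂) :=
  ⟨liftingBaseChangeIso₂ G Φ₂ hΦ₂⟩

/-- The first whiskered factorisation, unfolded. [folklore] -/
theorem liftingBaseChangeIso₁_hom : (liftingBaseChangeIso₁ G Φ₁ hΦ₁).hom =
    (Functor.associator DerivedCategory.Q (derivedLift Φ₁ hΦ₁) G.mapDerivedCategory).inv ≫
      Functor.whiskerRight (derivedLiftFac Φ₁ hΦ₁).hom G.mapDerivedCategory ≫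
        (Functor.associator Φ₁ DerivedCategory.Q G.mapDerivedCategory).hom ≫
          Functor.whiskerLeft Φ₁ G.mapDerivedCategoryFactors.hom ≫
            (Functor.associator Φ₁ (G.mapHomologicalComplex (ComplexShape.up ℤ)) DerivedCategory.Q).inv :=
  rfl

/-- The second whiskered factorisation, unfolded. [folklore] -/
theorem liftingBaseChangeIso₂_hom : (liftingBaseChangeIso₂ G Φ₂ hΦ₂).hom =
    (Functor.associator DerivedCategory.Q G.mapDerivedCategory (derivedLift Φ₂ hΦ₂)).inv ≫
      Functor.whiskerRight G.mapDerivedCategoryFactors.hom (derivedLift Φ₂ hΦ₂) ≫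
        (Functor.associator (G.mapHomologicalComplex (ComplexShape.up ℤ)) DerivedCategory.Q (derivedLift Φ₂ hΦ₂)).hom ≫
          Functor.whiskerLeft (G.mapHomologicalComplex (ComplexShape.up ℤ)) (derivedLiftFac Φ₂ hΦ₂).hom ≫
            (Functor.associator (G.mapHomologicalComplex (ComplexShape.up ℤ)) Φ₂ DerivedCategory.Q).inv :=
  rfl

/-- The first whiskered factorisation on an object. [folklore] -/
theorem liftingBaseChangeIso₁_hom_app (K : CochainComplex C₁ ℤ) :
    (liftingBaseChangeIso₁ G Φ₁ hΦ₁).hom.app K =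
      G.mapDerivedCategory.map ((derivedLiftFac Φ₁ hΦ₁).hom.app K) ≫ G.mapDerivedCategoryFactors.hom.app (Φ₁.obj K) := by
  rw [liftingBaseChangeIso₁_hom]
  simp only [NatTrans.comp_app, Functor.associator_inv_app, Functor.whiskerRight_app, Functor.associator_hom_app,
    Functor.whiskerLeft_app]
  erw [Category.id_comp, Category.id_comp, Category.comp_id]
  rfl

/-- The second whiskered factorisation on an object. [folklore] -/
theorem liftingBaseChangeIso₂_hom_app (K : CochainComplex C₁ ℤ) :
    (liftingBaseChangeIso₂ G Φ₂ hΦ₂).hom.app K =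
      (derivedLift Φ₂ hΦ₂).map (G.mapDerivedCategoryFactors.hom.app K) ≫
        (derivedLiftFac Φ₂ hΦ₂).hom.app ((G.mapHomologicalComplex (ComplexShape.up ℤ)).obj K) := by
  rw [liftingBaseChangeIso₂_hom]
  simp only [NatTrans.comp_app, Functor.associator_inv_app, Functor.whiskerRight_app, Functor.associator_hom_app,
    Functor.whiskerLeft_app]
  erw [Category.id_comp, Category.id_comp, Category.comp_id]
  rfl

/-- Its inverse on an object. [folklore] -/
theorem liftingBaseChangeIso₂_inv_app (K : CochainComplex C₁ ℤ) :
    (liftingBaseChangeIso₂ G Φ₂ hΦ₂).inv.app K =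
      (derivedLiftFac Φ₂ hΦ₂).inv.app ((G.mapHomologicalComplex (ComplexShape.up ℤ)).obj K) ≫
        (derivedLift Φ₂ hΦ₂).map (G.mapDerivedCategoryFactors.inv.app K) := by
  apply (cancel_epi ((liftingBaseChangeIso₂ G Φ₂ hΦ₂).hom.app K)).1
  rw [Iso.hom_inv_id_app, liftingBaseChangeIso₂_hom_app]
  erw [Category.assoc, Iso.hom_inv_id_app_assoc, ← Functor.map_comp, Iso.hom_inv_id_app,
    CategoryTheory.Functor.map_id]
  rfl

variable (τ : Φ₁ ⋙ G.mapHomologicalComplex (ComplexShape.up ℤ) ≅ G.mapHomologicalComplex (ComplexShape.up ℤ) ⋙ Φ₂)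

/-- **`derivedLift Φ₁ ⋙ D(G) ≅ D(G) ⋙ derivedLift Φ₂`** from `τ : Φ₁ ⋙ G• ≅ G• ⋙ Φ₂` (uniqueness of localization lifts along
`Q₁`, Mathlib `Localization.liftNatIso`). [cite: Weibel1994, §10.4 and Cor. 10.4.7] -/
def derivedLiftBaseChangeIso : derivedLift Φ₁ hΦ₁ ⋙ G.mapDerivedCategory ≅ G.mapDerivedCategory ⋙ derivedLift Φ₂ hΦ₂ :=
  Localization.liftNatIso DerivedCategory.Q (HomologicalComplex.quasiIso C₁ (ComplexShape.up ℤ))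
    ((Φ₁ ⋙ G.mapHomologicalComplex (ComplexShape.up ℤ)) ⋙ DerivedCategory.Q)
    ((G.mapHomologicalComplex (ComplexShape.up ℤ) ⋙ Φ₂) ⋙ DerivedCategory.Q) _ _
    (Functor.isoWhiskerRight τ DerivedCategory.Q)

/-- The comparison on `Q₁ K`: `e_{Q₁K} = (D(G)(Fac₁.hom_K) ≫ FacG.hom_{Φ₁K}) ≫ Q₂ τ_K ≫ (Fac₂.inv_{G•K} ≫ L₂(FacG.inv_K))`.
[folklore] -/
theorem derivedLiftBaseChangeIso_hom_app (K : CochainComplex C₁ ℤ) :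
    (derivedLiftBaseChangeIso G Φ₁ Φ₂ hΦ₁ hΦ₂ τ).hom.app (DerivedCategory.Q.obj K) =
      (G.mapDerivedCategory.map ((derivedLiftFac Φ₁ hΦ₁).hom.app K) ≫ G.mapDerivedCategoryFactors.hom.app (Φ₁.obj K)) ≫
        DerivedCategory.Q.map (τ.hom.app K) ≫
          ((derivedLiftFac Φ₂ hΦ₂).inv.app ((G.mapHomologicalComplex (ComplexShape.up ℤ)).obj K) ≫
            (derivedLift Φ₂ hΦ₂).map (G.mapDerivedCategoryFactors.inv.app K)) := by
  rw [derivedLiftBaseChangeIso, Localization.liftNatIso_hom, Localization.liftNatTrans_app, Functor.isoWhiskerRight_hom,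
    Functor.whiskerRight_app]
  change (liftingBaseChangeIso₁ G Φ₁ hΦ₁).hom.app K ≫ DerivedCategory.Q.map (τ.hom.app K) ≫
    (liftingBaseChangeIso₂ G Φ₂ hΦ₂).inv.app K = _
  rw [liftingBaseChangeIso₁_hom_app, liftingBaseChangeIso₂_inv_app]
  rfl

variable [Φ₁.CommShift ℤ] [Φ₂.CommShift ℤ]

/-- The first whiskered factorisation commutes with shifts. [folklore] -/
instance liftingBaseChangeIso₁_hom_commShift : NatTrans.CommShift (liftingBaseChangeIso₁ G Φ₁ hΦ₁).hom ℤ := by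
  rw [liftingBaseChangeIso₁_hom]; infer_instance

/-- The second whiskered factorisation commutes with shifts. [folklore] -/
instance liftingBaseChangeIso₂_hom_commShift : NatTrans.CommShift (liftingBaseChangeIso₂ G Φ₂ hΦ₂).hom ℤ := by
  rw [liftingBaseChangeIso₂_hom]; infer_instance

variable [NatTrans.CommShift τ.hom ℤ]

/-- **The comparison `derivedLift Φ₁ ⋙ D(G) ≅ D(G) ⋙ derivedLift Φ₂` commutes with shifts** when `Φ₁`, `Φ₂` and `τ` do.
[cite: Weibel1994, §10.4 and Cor. 10.4.7] -/
instance derivedLiftBaseChangeIso_hom_commShift :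
    NatTrans.CommShift (derivedLiftBaseChangeIso G Φ₁ Φ₂ hΦ₁ hΦ₂ τ).hom ℤ := by
  haveI : NatTrans.CommShift (Localization.Lifting.iso DerivedCategory.Q
      (HomologicalComplex.quasiIso C₁ (ComplexShape.up ℤ))
      ((Φ₁ ⋙ G.mapHomologicalComplex (ComplexShape.up ℤ)) ⋙ DerivedCategory.Q)
      (derivedLift Φ₁ hΦ₁ ⋙ G.mapDerivedCategory)).hom ℤ :=
    inferInstanceAs (NatTrans.CommShift (liftingBaseChangeIso₁ G Φ₁ hΦ₁).hom ℤ)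
  haveI : NatTrans.CommShift (Localization.Lifting.iso DerivedCategory.Q
      (HomologicalComplex.quasiIso C₁ (ComplexShape.up ℤ))
      ((G.mapHomologicalComplex (ComplexShape.up ℤ) ⋙ Φ₂) ⋙ DerivedCategory.Q)
      (G.mapDerivedCategory ⋙ derivedLift Φ₂ hΦ₂)).hom ℤ :=
    inferInstanceAs (NatTrans.CommShift (liftingBaseChangeIso₂ G Φ₂ hΦ₂).hom ℤ)
  haveI : NatTrans.CommShift (Functor.isoWhiskerRight τ DerivedCategory.Q).hom ℤ :=
    inferInstanceAs (NatTrans.CommShift (Functor.whiskerRight τ.hom DerivedCategory.Q) ℤ)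
  exact natTrans_commShift_liftNatTrans DerivedCategory.Q (HomologicalComplex.quasiIso C₁ (ComplexShape.up ℤ)) ℤ
    ((Φ₁ ⋙ G.mapHomologicalComplex (ComplexShape.up ℤ)) ⋙ DerivedCategory.Q)
    ((G.mapHomologicalComplex (ComplexShape.up ℤ) ⋙ Φ₂) ⋙ DerivedCategory.Q)
    (derivedLift Φ₁ hΦ₁ ⋙ G.mapDerivedCategory) (G.mapDerivedCategory ⋙ derivedLift Φ₂ hΦ₂)
    (Functor.isoWhiskerRight τ DerivedCategory.Q).hom

/-! ## §3 Base change and descent commute on shifted Homs -/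

set_option backward.isDefEq.respectTransparency false in
/-- **`G_*(Φ₁_*(y)) ≫ (Q₂ τ_L)⟦n⟧' = Q₂ τ_K ≫ Φ₂_*(G_*(y))`** for `y : Q₁ K ⟶ (Q₁ L)⟦n⟧`: the descended endofunctors commute
with the exact base change `G` on shifted Homs of complexes, up to the given `τ : Φ₁ ⋙ G• ≅ G• ⋙ Φ₂` (all factorisation
isomorphisms cancel; Mathlib `ShiftedHom.map_naturality` for the shift-compatible comparison of §2, `ShiftedHom.comp_map`).
[cite: Weibel1994, §10.4 and Cor. 10.4.7] -/
theorem mapShiftedHom_shiftedHomMap {K L : CochainComplex C₁ ℤ} {n : ℤ}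
    (y : ShiftedHom (DerivedCategory.Q.obj K) (DerivedCategory.Q.obj L) n) :
    mapShiftedHom G (shiftedHomMap Φ₁ hΦ₁ y) ≫ (DerivedCategory.Q.map (τ.hom.app L))⟦n⟧' =
      DerivedCategory.Q.map (τ.hom.app K) ≫ shiftedHomMap Φ₂ hΦ₂ (mapShiftedHom G y) := by
  -- (1) both sides as sandwiches around `y.map (L₁ ⋙ D(G))` resp. `y.map (D(G) ⋙ L₂)`
  have hL : mapShiftedHom G (shiftedHomMap Φ₁ hΦ₁ y) ≫ (DerivedCategory.Q.map (τ.hom.app L))⟦n⟧' =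
      (G.mapDerivedCategoryFactors.inv.app (Φ₁.obj K) ≫ G.mapDerivedCategory.map ((derivedLiftFac Φ₁ hΦ₁).inv.app K)) ≫
        y.map (derivedLift Φ₁ hΦ₁ ⋙ G.mapDerivedCategory) ≫
          (G.mapDerivedCategory.map ((derivedLiftFac Φ₁ hΦ₁).hom.app L) ≫
            G.mapDerivedCategoryFactors.hom.app (Φ₁.obj L) ≫ DerivedCategory.Q.map (τ.hom.app L))⟦n⟧' := by
    simp only [mapShiftedHom, shiftedHomMap_eq, ShiftedHom.map, Functor.comp_map, Functor.commShiftIso_comp_hom_app,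
      Functor.map_comp, Category.assoc]
    erw [Functor.commShiftIso_hom_naturality_assoc]
  have hR : DerivedCategory.Q.map (τ.hom.app K) ≫ shiftedHomMap Φ₂ hΦ₂ (mapShiftedHom G y) =
      (DerivedCategory.Q.map (τ.hom.app K) ≫
        (derivedLiftFac Φ₂ hΦ₂).inv.app ((G.mapHomologicalComplex (ComplexShape.up ℤ)).obj K) ≫
          (derivedLift Φ₂ hΦ₂).map (G.mapDerivedCategoryFactors.inv.app K)) ≫
        y.map (G.mapDerivedCategory ⋙ derivedLift Φ₂ hΦ₂) ≫
          ((derivedLift Φ₂ hΦ₂).map (G.mapDerivedCategoryFactors.hom.app L) ≫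
            (derivedLiftFac Φ₂ hΦ₂).hom.app ((G.mapHomologicalComplex (ComplexShape.up ℤ)).obj L))⟦n⟧' := by
    simp only [mapShiftedHom, shiftedHomMap_eq, ShiftedHom.map, Functor.comp_map, Functor.commShiftIso_comp_hom_app,
      Functor.map_comp, Category.assoc]
    erw [Functor.commShiftIso_hom_naturality_assoc]
  -- (2) the naturality square of the comparison `e` of §2 on shifted Homs, raw form
  have hnat := ShiftedHom.map_naturality y (derivedLiftBaseChangeIso G Φ₁ Φ₂ hΦ₁ hΦ₂ τ).hom
  rw [ShiftedHom.comp_mk₀, ShiftedHom.mk₀_comp] at hnat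
  -- (3) the heads and tails vs `e`
  have htail : G.mapDerivedCategory.map ((derivedLiftFac Φ₁ hΦ₁).hom.app L) ≫
      G.mapDerivedCategoryFactors.hom.app (Φ₁.obj L) ≫ DerivedCategory.Q.map (τ.hom.app L) =
      (derivedLiftBaseChangeIso G Φ₁ Φ₂ hΦ₁ hΦ₂ τ).hom.app (DerivedCategory.Q.obj L) ≫
        ((derivedLift Φ₂ hΦ₂).map (G.mapDerivedCategoryFactors.hom.app L) ≫
          (derivedLiftFac Φ₂ hΦ₂).hom.app ((G.mapHomologicalComplex (ComplexShape.up ℤ)).obj L)) := by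
    rw [derivedLiftBaseChangeIso_hom_app]
    simp only [Category.assoc]
    rw [← (derivedLift Φ₂ hΦ₂).map_comp_assoc, Iso.inv_hom_id_app]
    erw [CategoryTheory.Functor.map_id, Category.id_comp, Iso.inv_hom_id_app, Category.comp_id]
  have hhead : (G.mapDerivedCategoryFactors.inv.app (Φ₁.obj K) ≫
      G.mapDerivedCategory.map ((derivedLiftFac Φ₁ hΦ₁).inv.app K)) ≫
        (derivedLiftBaseChangeIso G Φ₁ Φ₂ hΦ₁ hΦ₂ τ).hom.app (DerivedCategory.Q.obj K) =
      DerivedCategory.Q.map (τ.hom.app K) ≫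
        (derivedLiftFac Φ₂ hΦ₂).inv.app ((G.mapHomologicalComplex (ComplexShape.up ℤ)).obj K) ≫
          (derivedLift Φ₂ hΦ₂).map (G.mapDerivedCategoryFactors.inv.app K) := by
    rw [derivedLiftBaseChangeIso_hom_app]
    simp only [Category.assoc]
    rw [← G.mapDerivedCategory.map_comp_assoc, Iso.inv_hom_id_app]
    erw [CategoryTheory.Functor.map_id, Category.id_comp, Iso.inv_hom_id_app_assoc]
  -- (4) assemble
  rw [hL, hR, htail]
  simp only [Functor.map_comp, Category.assoc, reassoc_of% hnat, reassoc_of% hhead]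

end BaseChange

end Summit.Ventures.HSemireg

end
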